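import Summits.Ventures.CertifiedManyBodySolver.Downfold.EmeryOrbitalWeightFaceDirCert
import Summits.Ventures.CertifiedManyBodySolver.Downfold.EmeryChargeTransferSlopeBox
import HarnessLib

/-!
# The ANTINODAL Fermi-surface Cu-d weight over a typed box WITHOUT the antinodal charge-transfer regime at the low-Δ corners:
# the regime-free fixed-filling Δ-step (directional certificate + slope law + mean value theorem), the `t_pp′`-decoupled lower edge, and the v2 corner rule
# (INFL-3to1-B §B.90 (j), part 3 of 3 — the device for the (K) cuprate source boxes and box #19, where the v1 rule `EmeryOrbitalWeightFaceBox` does not apply)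

Venture CertifiedManyBodySolver, cell `pub/hubbard-downfold` (stage S1; INFLATION-RULES-3to1-B §B.90 (a)–(j)), seat hubbard-downfold-mod-4 (technique B, g39); namespace
`Summit.Ventures.CertifiedManyBodySolver.Downfold.Emery`. Sequel of `EmeryOrbitalWeightFaceDir` (segment step `dWeightFaceCF_seg_mono`), `EmeryOrbitalWeightFaceDirCert`
(region certificate `faceDir_nonneg_of_mem_region`, `κ₀ = 1/10`), `EmeryOrbitalWeightFaceBox` (v1 rule, `faceU_nonneg_on_box`, `dWeightFaceCF`) and
`EmeryChargeTransferSlopeBox` (`fermiEnergyOf_slope_law`). Everything PROVED (0 sorry).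
WHAT THIS IS NOT: a statement about any material; `U = 0` one-body kinematics of the σ (d–pₓ–p_y + t_pp + t_pp′) model.

* §1 `dWeightFace_fermi_mono_Delta_dir`: **`Δ ≤ Δ′ ⇒ W(Δ) ≤ W(Δ′)` at fixed filling WITHOUT the regime**, from hole-likeness at both rows, the energy bracket `[E_l, E_h]` with the
  upper face edge below `E_h`, the slope law `ε_F(Δ′) + κδ ≤ ε_F(Δ)` and a directional certificate `faceSD + κ₀faceSE ≥ 0` (`κ₀ ≤ κ`) on `[Δ, Δ′] × [E_l, E_h] ∩ {faceG ≥ 0}`: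
  the straight segment from `(Δ, ε_F(Δ))` to `(Δ′, ε_F(Δ′))` has slope `−λ`, `λ ∈ [κ, 1]` (Lipschitz + slope law), and `dWeightFaceCF_seg_mono` applies.
* §2 THE `t_pp′`-DECOUPLED LOWER EDGE: on `c ∈ [c₁, c₂]` at fixed `(Δ, a, b, ε)` in the window, `faceN(c) ≥ faceN(c₁)` and `faceR(c) ≤ faceRUp(c₁, c₂)` (each factor
  bounded at the worse end) ⇒ `dWeightFaceCF(c) ≥ dWeightFaceLoDec := a²faceN(c₁)/(a²faceN(c₁) + faceRUp)` — no `t_pp′`-lever (which is NOT sign-definite there) needed.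
* §3 THE v2 THREE-COORDINATE RULE `dWeightFace_fermiEnergyOf_mem_Icc_of_mem_box3_dir`: for every member of `[Δ₁, Δ₂] × {a} × [b₁, b₂] × [c₁, c₂]` at filling `ν`:
  **`dWeightFaceLoDec(Δ₁, a, b₂, c₁, c₂; E_h) ≤ W(Δ, a, b, c) ≤ W(Δ₂, a, b₁, c₂)`** given hole-likeness on the box, `E_h`/`E_v` corner brackets with the four upper-edge corner
  inequalities and `c₂E_h < a²`, the regime ONLY at the upper corner `4(b₁ + c₂) ≤ Δ₂ + E_v`, the slope-law side conditions at `(Δ₁; Δ₂, c₂; E_low < E_v)` and the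
  directional certificate on the box × `[E_v, E_h]`; numeric form `…_num`, and the four-coordinate typed box by normalisation to `t_pd = 1` with the certificate DISCHARGED by the
  region theorem (`…_box4_dir_num`: the normalised box must sit inside `[7/10, 16/5] × [3/10, 4/5] × [0, 1/5]` with `[E_v, E_h] ⊂ [7/10, 2]`, `κ₀ = 1/10`).

Sources: three-band model [HybertsenSchluterChristensen1989, Eq. (1)]; bilinear contour / face point [AndersenEtAl1995, §6]; mean value theorem, Handelman certificates [folklore].
-/

noncomputable section

namespace Summit.Ventures.CertifiedManyBodySolver.Downfold.Emery

open Real Set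

/-! ## §1 The regime-free Δ-step at fixed filling -/

/-- **Δ-STEP AT FIXED FILLING WITHOUT THE REGIME.** `0 < Δ`, `δ ≥ 0`, `a > 0`, `0 ≤ c ≤ b`, `0 < ν < 1`; hole-likeness of both rows at `ν`; `ε_F(Δ) ≤ E_h`, `cE_h < a²`;
`0 < E_l ≤ ε_F(Δ + δ)`; the upper face edge at every `(D, e)`, `D ∈ [Δ, Δ + δ]`, `0 < e ≤ E_h`; the slope law `ε_F(Δ + δ) + κδ ≤ ε_F(Δ)`; `0 ≤ κ₀ ≤ κ`; and the directional
certificate `faceG ≥ 0 ⇒ faceSD + κ₀faceSE ≥ 0` on `[Δ, Δ + δ] × [E_l, E_h]` ⇒ **`W(Δ) ≤ W(Δ + δ)`**, `W(θ) = dWeightFace(θ; ε_F(θ; ν))`. [folklore] -/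
theorem dWeightFace_fermi_mono_Delta_dir {Δ δ a b c ν κ₀ κ El Eh : ℝ} (hΔ : 0 < Δ) (hδ : 0 ≤ δ) (ha : 0 < a) (hc : 0 ≤ c) (hcb : c ≤ b)
    (hν0 : 0 < ν) (hν1 : ν < 1) (hκ₀ : 0 ≤ κ₀) (hκ : κ₀ ≤ κ)
    (hG0 : 0 ≤ faceG Δ a c (fermiEnergyOf Δ a b c ν)) (hG1 : 0 ≤ faceG (Δ + δ) a c (fermiEnergyOf (Δ + δ) a b c ν))
    (hEh : fermiEnergyOf Δ a b c ν ≤ Eh) (hm : c * Eh < a ^ 2) (hEl0 : 0 < El) (hEl : El ≤ fermiEnergyOf (Δ + δ) a b c ν)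
    (hU : ∀ D e : ℝ, D ∈ Icc Δ (Δ + δ) → 0 < e → e ≤ Eh → 0 ≤ faceU D a b c e)
    (hslope : fermiEnergyOf (Δ + δ) a b c ν + κ * δ ≤ fermiEnergyOf Δ a b c ν)
    (hdir : ∀ D e : ℝ, D ∈ Icc Δ (Δ + δ) → e ∈ Icc El Eh → 0 ≤ faceG D a c e → 0 ≤ faceSD D a b c e + κ₀ * faceSE D a b c e) :
    dWeightFace Δ a b c (fermiEnergyOf Δ a b c ν) ≤ dWeightFace (Δ + δ) a b c (fermiEnergyOf (Δ + δ) a b c ν) := by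
  have hb : 0 ≤ b := hc.trans hcb
  have ha' : a ≠ 0 := ha.ne'
  set ε := fermiEnergyOf Δ a b c ν with hεdef
  set ε' := fermiEnergyOf (Δ + δ) a b c ν with hε'def
  have hε'0 : 0 < ε' := lt_of_lt_of_le hEl0 hEl
  have hε0 : 0 < ε := fermiEnergyOf_pos hΔ ha' hc hb hν0 hν1
  have hex : ∃ e : ℝ, abFilling Δ a b c e = ν := exists_abFilling_eq hΔ ha' hc hb hν0 hν1
  have hex' : ∃ e : ℝ, abFilling (Δ + δ) a b c e = ν := exists_abFilling_eq (by linarith) ha' hc hb hν0 hν1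
  have hle : ε' ≤ ε := fermiEnergyOf_shift_le hΔ ha' hc hb hδ hν0 hν1 hex hex'
  have hlip : ε - δ ≤ ε' := fermiEnergyOf_sub_le_shift hΔ.le hc hb hδ hν0 hν1 hex hex'
  have hmε : c * ε < a ^ 2 := lt_of_le_of_lt (mul_le_mul_of_nonneg_left hEh hc) hm
  have hmε' : c * ε' < a ^ 2 := lt_of_le_of_lt (mul_le_mul_of_nonneg_left (hle.trans hEh) hc) hm
  -- closed forms at both ends
  have e0 : dWeightFace Δ a b c ε = dWeightFaceCF Δ a b c ε := dWeightFace_eq_CF (by linarith) hc hcb hε0 hmε hG0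
  have e1 : dWeightFace (Δ + δ) a b c ε' = dWeightFaceCF (Δ + δ) a b c ε' := dWeightFace_eq_CF (by linarith) hc hcb hε'0 hmε' hG1
  rw [e0, e1]
  rcases eq_or_lt_of_le hδ with h0 | hδpos
  · -- δ = 0
    have hεε : ε' = ε := by rw [hε'def, hεdef, ← h0, add_zero]
    rw [← h0, add_zero, hεε]
  · -- δ > 0: the segment slope λ = (ε − ε')/δ ∈ [κ, 1]
    set l := (ε - ε') / δ with hl
    have hlδ : l * δ = ε - ε' := by rw [hl]; field_simp
    have hl1 : l ≤ 1 := by rw [hl, div_le_one hδpos]; linarith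
    have hκl : κ ≤ l := by rw [hl, le_div_iff₀ hδpos]; linarith
    have hεl : ε - l * δ = ε' := by rw [hlδ]; ring
    have hstep := dWeightFaceCF_seg_mono (Δ := Δ) (a := a) (b := b) (c := c) (ε := ε) (l := l) (δ := δ) (κ₀ := κ₀) hΔ ha' hc hcb hδ hκ₀
      (hκ.trans hκl) hl1 (by rw [hεl]; exact hε'0) hmε hG0 (by rw [hεl]; exact hG1) ?_ ?_
    · rw [hεl] at hstep; exact hstep
    · intro t ht
      have hl0 : 0 ≤ l := hκ₀.trans (hκ.trans hκl)
      have het : ε' ≤ ε - l * t := by rw [← hεl]; nlinarith [ht.2]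
      have het' : ε - l * t ≤ ε := by nlinarith [ht.1]
      exact hU (Δ + t) (ε - l * t) ⟨by linarith [ht.1], by linarith [ht.2]⟩ (lt_of_lt_of_le hε'0 het) (het'.trans hEh)
    · intro t ht hGt
      have hl0 : 0 ≤ l := hκ₀.trans (hκ.trans hκl)
      have het : ε' ≤ ε - l * t := by rw [← hεl]; nlinarith [ht.2]
      have het' : ε - l * t ≤ ε := by nlinarith [ht.1]
      exact hdir (Δ + t) (ε - l * t) ⟨by linarith [ht.1], by linarith [ht.2]⟩ ⟨hEl.trans het, het'.trans hEh⟩ hGt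

/-! ## §2 The `t_pp′`-decoupled lower edge -/

/-- Upper bound of `faceR` over `t_pp′ ∈ [c₁, c₂]` with each factor at its worse end:
`faceRUp = εE²(a² − c₁ε) + 8(2a²(c₂ + b) + ε(b² − c₁²))·(εE − 2(a² − c₂ε))`. [folklore] -/
def faceRUp (Δ a b c₁ c₂ ε : ℝ) : ℝ :=
  ε * (Δ + ε) ^ 2 * (a ^ 2 - c₁ * ε) + 8 * (2 * a ^ 2 * (c₂ + b) + ε * (b ^ 2 - c₁ ^ 2)) * (ε * (Δ + ε) - 2 * (a ^ 2 - c₂ * ε))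

/-- The `t_pp′`-decoupled lower edge of the antinodal weight: `dWeightFaceLoDec = a²faceN(c₁)/(a²faceN(c₁) + faceRUp(c₁, c₂))`. [folklore] -/
def dWeightFaceLoDec (Δ a b c₁ c₂ ε : ℝ) : ℝ := a ^ 2 * faceN Δ b c₁ ε / (a ^ 2 * faceN Δ b c₁ ε + faceRUp Δ a b c₁ c₂ ε)

/-- `faceR(c) ≤ faceRUp(c₁, c₂)` for `c ∈ [c₁, c₂]` (`0 ≤ c₁`, `c ≤ b`, `ε ≥ 0`, and `2(a² − cε) ≤ εE` — implied by `faceG ≥ 0` with `cε < a²`). [folklore] -/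
theorem faceR_le_faceRUp {Δ a b c c₁ c₂ ε : ℝ} (hε : 0 ≤ ε) (hc₁ : 0 ≤ c₁) (hc : c ∈ Icc c₁ c₂) (hcb : c ≤ b)
    (hK : 2 * (a ^ 2 - c * ε) ≤ ε * (Δ + ε)) : faceR Δ a b c ε ≤ faceRUp Δ a b c₁ c₂ ε := by
  have hc0 : 0 ≤ c := hc₁.trans hc.1
  have hF : 0 ≤ fsN a b c ε := fsN_nonneg hc0 hcb hε
  have hFF : fsN a b c ε ≤ 2 * a ^ 2 * (c₂ + b) + ε * (b ^ 2 - c₁ ^ 2) := by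
    unfold fsN
    have h1 : c₁ ^ 2 ≤ c ^ 2 := by nlinarith [hc.1]
    nlinarith [hc.2, mul_le_mul_of_nonneg_left h1 hε, sq_nonneg a]
  have hK0 : 0 ≤ ε * (Δ + ε) - 2 * (a ^ 2 - c * ε) := by linarith
  have hKK : ε * (Δ + ε) - 2 * (a ^ 2 - c * ε) ≤ ε * (Δ + ε) - 2 * (a ^ 2 - c₂ * ε) := by nlinarith [hc.2]
  have hprod := mul_le_mul hFF hKK hK0 (hF.trans hFF)
  have hpos : 0 ≤ ε * (Δ + ε) ^ 2 := by positivity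
  have h1 : ε * (Δ + ε) ^ 2 * (a ^ 2 - c * ε) ≤ ε * (Δ + ε) ^ 2 * (a ^ 2 - c₁ * ε) :=
    mul_le_mul_of_nonneg_left (by nlinarith [hc.1]) hpos
  unfold faceR faceRUp
  nlinarith

/-- **THE DECOUPLED LOWER EDGE**: on the window (`Δ + ε > 0`, `ε > 0`, `0 ≤ c₁ ≤ c ≤ c₂ ≤ b`, `c₂ε < a²`, `faceG(c; ε) ≥ 0`):
`dWeightFaceLoDec(Δ, a, b, c₁, c₂; ε) ≤ dWeightFaceCF(Δ, a, b, c; ε)`. [folklore] -/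
theorem dWeightFaceLoDec_le_CF {Δ a b c c₁ c₂ ε : ℝ} (hE : 0 < Δ + ε) (hε : 0 < ε) (hc₁ : 0 ≤ c₁) (hc : c ∈ Icc c₁ c₂) (hcb : c₂ ≤ b)
    (hm : c₂ * ε < a ^ 2) (hG : 0 ≤ faceG Δ a c ε) : dWeightFaceLoDec Δ a b c₁ c₂ ε ≤ dWeightFaceCF Δ a b c ε := by
  have hc0 : 0 ≤ c := hc₁.trans hc.1
  have hb : 0 ≤ b := (hc0.trans hc.2).trans hcb
  have hmc : c * ε < a ^ 2 := lt_of_le_of_lt (mul_le_mul_of_nonneg_right hc.2 hε.le) hm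
  have hR : 0 < faceR Δ a b c ε := faceR_pos hE hc0 (hc.2.trans hcb) hε hmc hG
  have hK : 2 * (a ^ 2 - c * ε) ≤ ε * (Δ + ε) := by unfold faceG at hG; nlinarith
  have hRU := faceR_le_faceRUp hε.le hc₁ hc (hc.2.trans hcb) hK
  have hN1 : 0 < faceN Δ b c₁ ε := faceN_pos (Δ := Δ) (ε := ε) hE (by linarith : 0 ≤ b + c₁)
  have hNN : faceN Δ b c₁ ε ≤ faceN Δ b c ε := by
    unfold faceN
    have h1 : 0 ≤ (Δ + ε) + 4 * (b + c₁) := by linarith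
    have h2 : (Δ + ε) + 4 * (b + c₁) ≤ (Δ + ε) + 4 * (b + c) := by linarith [hc.1]
    have h3 : ((Δ + ε) + 4 * (b + c₁)) ^ 2 ≤ ((Δ + ε) + 4 * (b + c)) ^ 2 := pow_le_pow_left₀ h1 h2 2
    exact mul_le_mul_of_nonneg_left h3 hE.le
  have ha2 : 0 ≤ a ^ 2 := sq_nonneg a
  unfold dWeightFaceLoDec dWeightFaceCF
  rw [frac_le_frac_iff_cross (mul_nonneg ha2 hN1.le) (mul_nonneg ha2 (hN1.le.trans hNN)) (lt_of_lt_of_le hR hRU) hR]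
  have : 0 ≤ faceN Δ b c ε * faceRUp Δ a b c₁ c₂ ε - faceN Δ b c₁ ε * faceR Δ a b c ε := by nlinarith [hR.le, hN1.le]
  nlinarith [mul_nonneg ha2 this]

/-! ## §3 The v2 three-coordinate corner rule (regime only at the upper corner) -/

/-- The slope-law side conditions move along the box: from `c₂(Δ₁(E_low + E_h) + E_lowE_h) ≤ a²Δ₁` and `c₂(E_low + E_h) ≤ a²` to any `Δ ≥ Δ₁`, `c ≤ c₂`. [folklore] -/
theorem slope_margin_of_corner {Δ Δ₁ a c c₂ Elow Eh : ℝ} (hΔ : Δ₁ ≤ Δ) (hc : c ≤ c₂) (hE : 0 ≤ Elow + Eh) (hEE : 0 ≤ Elow * Eh)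
    (hΔ₁ : 0 ≤ Δ₁) (hlev : c₂ * (Δ₁ * (Elow + Eh) + Elow * Eh) ≤ a ^ 2 * Δ₁) (hsl : c₂ * (Elow + Eh) ≤ a ^ 2) :
    c * (Δ * (Elow + Eh) + Elow * Eh) ≤ a ^ 2 * Δ ∧ c * (Elow + Eh) ≤ a ^ 2 := by
  have hΔ0 : 0 ≤ Δ := hΔ₁.trans hΔ
  constructor
  · have h1 : c * (Δ * (Elow + Eh) + Elow * Eh) ≤ c₂ * (Δ * (Elow + Eh) + Elow * Eh) :=
      mul_le_mul_of_nonneg_right hc (by positivity)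
    have e : c₂ * (Δ * (Elow + Eh) + Elow * Eh) = c₂ * (Δ₁ * (Elow + Eh) + Elow * Eh) + (Δ - Δ₁) * (c₂ * (Elow + Eh)) := by ring
    have h2 := mul_le_mul_of_nonneg_left hsl (sub_nonneg.2 hΔ)
    nlinarith
  · exact (mul_le_mul_of_nonneg_right hc hE).trans hsl

/-- **THE v2 THREE-COORDINATE CORNER RULE FOR THE ANTINODAL FERMI-SURFACE Cu-d WEIGHT AT FIXED `t_pd`, regime only at the UPPER corner.** For every
`(Δ, b, c) ∈ [Δ₁, Δ₂] × [b₁, b₂] × [c₁, c₂]` (`Δ₁ > 0`, `a > 0`, `0 ≤ c₁`, `c₂ ≤ b₁`, `b₁ > 0`) at filling `0 < ν < 1`, given (i) hole-likeness on the box `1 − 2ν ≤ x_VH`,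
(ii) `E_h ≥ ε_F(Δ₁, a, b₂, c₁; ν)` with `c₂E_h < a²` and the upper face edge at `E_h` at the four corners `(Δᵢ, b₁, cⱼ)`, (iii) `0 < E_v ≤ ε_F(Δ₂, a, b₁, c₂; ν)` and the
regime at the upper corner only, `4(b₁ + c₂) ≤ Δ₂ + E_v`, (iv) the slope-law side conditions `0 < E_low < E_v`, `0 ≤ κ₀ ≤ κ`, `κ + dWeightAxisCF(Δ₂, a, c₂; E_low) < 1`,
`c₂(Δ₁(E_low + E_h) + E_lowE_h) ≤ a²Δ₁`, `c₂(E_low + E_h) ≤ a²`, and (v) the directional certificate on the box × `[E_v, E_h]`: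
**`dWeightFaceLoDec(Δ₁, a, b₂, c₁, c₂; E_h) ≤ W(Δ, a, b, c) ≤ W(Δ₂, a, b₁, c₂)`**. [folklore] -/
theorem dWeightFace_fermiEnergyOf_mem_Icc_of_mem_box3_dir {Δ a b c Δ₁ Δ₂ b₁ b₂ c₁ c₂ ν Eh Ev Elow κ₀ κ : ℝ} (hΔ₁ : 0 < Δ₁) (ha : 0 < a) (hc₁ : 0 ≤ c₁)
    (hcb : c₂ ≤ b₁) (hb₁ : 0 < b₁) (hΔ : Δ ∈ Icc Δ₁ Δ₂) (hb : b ∈ Icc b₁ b₂) (hc : c ∈ Icc c₁ c₂) (hν0 : 0 < ν) (hν1 : ν < 1)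
    (hVH : ∀ Δ' b' c' : ℝ, Δ' ∈ Icc Δ₁ Δ₂ → b' ∈ Icc b₁ b₂ → c' ∈ Icc c₁ c₂ → 1 - 2 * ν ≤ xVH Δ' a b' c')
    (hEh : fermiEnergyOf Δ₁ a b₂ c₁ ν ≤ Eh) (hm : c₂ * Eh < a ^ 2)
    (hU11 : 0 ≤ faceU Δ₁ a b₁ c₁ Eh) (hU12 : 0 ≤ faceU Δ₁ a b₁ c₂ Eh) (hU21 : 0 ≤ faceU Δ₂ a b₁ c₁ Eh) (hU22 : 0 ≤ faceU Δ₂ a b₁ c₂ Eh)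
    (hEv : Ev ≤ fermiEnergyOf Δ₂ a b₁ c₂ ν) (hEv0 : 0 < Ev) (hR2 : 4 * (b₁ + c₂) ≤ Δ₂ + Ev)
    (hElow : 0 < Elow) (hEl : Elow < Ev) (hκ₀ : 0 ≤ κ₀) (hκ : κ₀ ≤ κ) (hκW : κ + dWeightAxisCF Δ₂ a c₂ Elow < 1)
    (hlev : c₂ * (Δ₁ * (Elow + Eh) + Elow * Eh) ≤ a ^ 2 * Δ₁) (hsl : c₂ * (Elow + Eh) ≤ a ^ 2)
    (hdir : ∀ D B C e : ℝ, D ∈ Icc Δ₁ Δ₂ → B ∈ Icc b₁ b₂ → C ∈ Icc c₁ c₂ → e ∈ Icc Ev Eh → 0 ≤ faceG D a C e →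
      0 ≤ faceSD D a B C e + κ₀ * faceSE D a B C e) :
    dWeightFace Δ a b c (fermiEnergyOf Δ a b c ν) ∈
      Icc (dWeightFaceLoDec Δ₁ a b₂ c₁ c₂ Eh) (dWeightFace Δ₂ a b₁ c₂ (fermiEnergyOf Δ₂ a b₁ c₂ ν)) := by
  -- positivity bookkeeping on the box
  have hΔ₂ : 0 < Δ₂ := lt_of_lt_of_le hΔ₁ (hΔ.1.trans hΔ.2)
  have hc₂ : 0 ≤ c₂ := hc₁.trans (hc.1.trans hc.2)
  have hb₁' : 0 ≤ b₁ := hb₁.le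
  have hb₂ : 0 ≤ b₂ := hb₁'.trans (hb.1.trans hb.2)
  have hΔ0 : 0 < Δ := lt_of_lt_of_le hΔ₁ hΔ.1
  have hc0 : 0 ≤ c := hc₁.trans hc.1
  have hb0 : 0 ≤ b := hb₁'.trans hb.1
  have ha' : a ≠ 0 := ha.ne'
  have hex : ∀ {D B C : ℝ}, 0 < D → 0 ≤ B → 0 ≤ C → ∃ ε : ℝ, abFilling D a B C ε = ν :=
    fun hD hB hC => exists_abFilling_eq hD ha' hC hB hν0 hν1
  have hΔ₁m : Δ₁ ∈ Icc Δ₁ Δ₂ := ⟨le_rfl, hΔ.1.trans hΔ.2⟩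
  have hΔ₂m : Δ₂ ∈ Icc Δ₁ Δ₂ := ⟨hΔ.1.trans hΔ.2, le_rfl⟩
  have hb₁m : b₁ ∈ Icc b₁ b₂ := ⟨le_rfl, hb.1.trans hb.2⟩
  have hb₂m : b₂ ∈ Icc b₁ b₂ := ⟨hb.1.trans hb.2, le_rfl⟩
  have hc₁m : c₁ ∈ Icc c₁ c₂ := ⟨le_rfl, hc.1.trans hc.2⟩
  have hc₂m : c₂ ∈ Icc c₁ c₂ := ⟨hc.1.trans hc.2, le_rfl⟩
  -- every box Fermi energy lies in [ε_F(Δ₂, a, b₁, c₂), ε_F(Δ₁, a, b₂, c₁)] ⊂ [Ev, Eh]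
  have hEbox : ∀ {D B C : ℝ}, D ∈ Icc Δ₁ Δ₂ → B ∈ Icc b₁ b₂ → C ∈ Icc c₁ c₂ →
      Ev ≤ fermiEnergyOf D a B C ν ∧ fermiEnergyOf D a B C ν ≤ Eh := by
    intro D B C hD hB hC
    have h := fermiEnergyOf_mem_Icc_of_mem_box' hΔ₁ ha hb₁' hc₁ hD ⟨le_rfl, le_rfl⟩ hB hC hν0 hν1
    exact ⟨hEv.trans h.1, h.2.trans hEh⟩
  have hεpos : ∀ {D B C : ℝ}, 0 < D → 0 ≤ B → 0 ≤ C → 0 < fermiEnergyOf D a B C ν :=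
    fun hD hB hC => fermiEnergyOf_pos hD ha' hC hB hν0 hν1
  -- hole-likeness at any box point
  have hGof : ∀ {D B C : ℝ}, D ∈ Icc Δ₁ Δ₂ → B ∈ Icc b₁ b₂ → C ∈ Icc c₁ c₂ → 0 ≤ faceG D a C (fermiEnergyOf D a B C ν) := by
    intro D B C hD hB hC
    exact faceG_fermiEnergyOf_nonneg_of_xVH (lt_of_lt_of_le hΔ₁ hD.1) ha' (hc₁.trans hC.1) (hb₁'.trans hB.1) hν0 hν1 (hVH D B C hD hB hC)
  -- upper face edge at any (D, B ≥ b₁, C) box point and any energy 0 < ε ≤ Eh (both forms)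
  have hUof' : ∀ {D B C ε : ℝ}, D ∈ Icc Δ₁ Δ₂ → B ∈ Icc b₁ b₂ → C ∈ Icc c₁ c₂ → 0 < ε → ε ≤ Eh → 0 ≤ faceU D a B C ε := by
    intro D B C ε hD hB hC hε0 hεh
    have hC0 : 0 ≤ C := hc₁.trans hC.1
    have hU := faceU_nonneg_on_box (hε0.le.trans hεh) hb₁' hD hB.1 hC hU11 hU12 hU21 hU22
    exact (faceU_nonneg_iff _ _ _ _ _).2
      (faceHi_anti (lt_of_lt_of_le hΔ₁ hD.1).le hC0 (by linarith [hb₁'.trans hB.1]) hε0 hεh ((faceU_nonneg_iff _ _ _ _ _).1 hU))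
  have hUof : ∀ {D B C ε : ℝ}, D ∈ Icc Δ₁ Δ₂ → B ∈ Icc b₁ b₂ → C ∈ Icc c₁ c₂ → 0 < ε → ε ≤ Eh →
      cA D ε ≤ 8 * fsD D a C ε + 16 * fsN a B C ε :=
    fun hD hB hC hε0 hεh => (faceU_nonneg_iff _ _ _ _ _).1 (hUof' hD hB hC hε0 hεh)
  -- margins
  have hmof : ∀ {C ε : ℝ}, C ∈ Icc c₁ c₂ → ε ≤ Eh → 0 < ε → C * ε < a ^ 2 := by
    intro C ε hC hεh hε0
    calc C * ε ≤ c₂ * Eh := mul_le_mul hC.2 hεh hε0.le hc₂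
      _ < a ^ 2 := hm
  have hEh0 : 0 < Eh := lt_of_lt_of_le (hεpos hΔ₁ hb₂ hc₁) hEh
  have hEvEh : Ev ≤ Eh := (hEbox hΔ₁m hb₁m hc₁m).1.trans (hEbox hΔ₁m hb₁m hc₁m).2
  -- the regime-free Δ-step on a sub-interval [D, D'] ⊂ [Δ₁, Δ₂] at any (B, C) of the box
  have hstepΔ : ∀ {D D' B C : ℝ}, Δ₁ ≤ D → D ≤ D' → D' ≤ Δ₂ → B ∈ Icc b₁ b₂ → C ∈ Icc c₁ c₂ →
      dWeightFace D a B C (fermiEnergyOf D a B C ν) ≤ dWeightFace D' a B C (fermiEnergyOf D' a B C ν) := by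
    intro D D' B C hD hDD' hD' hB hC
    have hD0 : 0 < D := lt_of_lt_of_le hΔ₁ hD
    have hB0 : 0 < B := lt_of_lt_of_le hb₁ hB.1
    have hC0 : 0 ≤ C := hc₁.trans hC.1
    have hCB : C ≤ B := (hC.2.trans hcb).trans hB.1
    have hDm : D ∈ Icc Δ₁ Δ₂ := ⟨hD, hDD'.trans hD'⟩
    have hD'm : D' ∈ Icc Δ₁ Δ₂ := ⟨hD.trans hDD', hD'⟩
    obtain ⟨δ, rfl⟩ : ∃ δ, D' = D + δ := ⟨D' - D, by ring⟩
    have hδ : 0 ≤ δ := by linarith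
    -- slope law on [D, D + δ] at (B, C)
    obtain ⟨hlevC, hslC⟩ := slope_margin_of_corner (a := a) hD hC.2 (by linarith) (mul_nonneg hElow.le hEh0.le) hΔ₁.le hlev hsl
    have hκC : κ + dWeightAxisCF (D + δ) a C Elow < 1 := by
      have h1 : dWeightAxisCF (D + δ) a C Elow ≤ dWeightAxisCF Δ₂ a C Elow :=
        dWeightAxisCF_mono_Delta (by linarith) hD' hElow.le hC0
          (lt_of_le_of_lt (mul_le_mul_of_nonneg_left (by linarith [hEvEh] : Elow ≤ Eh) hC0) (hmof hC le_rfl hEh0))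
      have h2 : dWeightAxisCF Δ₂ a C Elow ≤ dWeightAxisCF Δ₂ a c₂ Elow :=
        dWeightAxisCF_mono_tppP hΔ₂ hElow.le hC0 hC.2 (lt_of_le_of_lt (mul_le_mul_of_nonneg_left (by linarith [hEvEh] : Elow ≤ Eh) hc₂) hm)
      linarith
    have hslope := fermiEnergyOf_slope_law (Δ₁ := D) (Δ₂ := D + δ) (a := a) (b := B) (c := C) (ν := ν) (κ := κ) (Elow := Elow) (El := Ev) (Eh := Eh)
      hD0 (by linarith) ha' hC0 hCB hB0 hν0 hν1 hElow hEl (hEbox hD'm hB hC).1 (hEbox hDm hB hC).2 (hmof hC le_rfl hEh0) hlevC hslC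
      (hκ₀.trans hκ) hκC
    have hslope' : fermiEnergyOf (D + δ) a B C ν + κ * δ ≤ fermiEnergyOf D a B C ν := by
      simpa [add_sub_cancel_left] using hslope
    refine dWeightFace_fermi_mono_Delta_dir hD0 hδ ha hC0 hCB hν0 hν1 hκ₀ hκ (hGof hDm hB hC) (hGof hD'm hB hC) (hEbox hDm hB hC).2
      (hmof hC le_rfl hEh0) hEv0 (hEbox hD'm hB hC).1 ?_ hslope' ?_
    · intro D₀ e hD₀ he0 heh
      exact hUof' ⟨hD.trans hD₀.1, hD₀.2.trans hD'⟩ hB hC he0 heh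
    · intro D₀ e hD₀ he hG
      exact hdir D₀ B C e ⟨hD.trans hD₀.1, hD₀.2.trans hD'⟩ hB hC he hG
  constructor
  · -- LOWER: loDec ≤ CF(Δ₁, b₂, c; Eh) ≤ W(Δ₁, b₂, c) ≤ W(Δ₁, b, c) ≤ W(Δ, b, c)
    have l1 : dWeightFace Δ₁ a b c (fermiEnergyOf Δ₁ a b c ν) ≤ dWeightFace Δ a b c (fermiEnergyOf Δ a b c ν) :=
      hstepΔ le_rfl hΔ.1 hΔ.2 hb hc
    have l2 : dWeightFace Δ₁ a b₂ c (fermiEnergyOf Δ₁ a b₂ c ν) ≤ dWeightFace Δ₁ a b c (fermiEnergyOf Δ₁ a b c ν) :=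
      dWeightFace_fermi_anti_tpp hΔ₁ ha hc0 ((hc.2.trans hcb).trans hb.1) hb.2 hν0 hν1 (hGof hΔ₁m hb hc)
        (hmof hc (hEbox hΔ₁m hb₂m hc).2 (hεpos hΔ₁ hb₂ hc0)) (hUof hΔ₁m hb₂m hc (hεpos hΔ₁ hb₂ hc0) (hEbox hΔ₁m hb₂m hc).2)
    -- at the corner row (Δ₁, b₂, c): W = dWeightFace(ε₁) ≥ dWeightFace(Eh) = CF(Eh) ≥ loDec
    have hε1 : 0 < fermiEnergyOf Δ₁ a b₂ c ν := hεpos hΔ₁ hb₂ hc0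
    have hε1h : fermiEnergyOf Δ₁ a b₂ c ν ≤ Eh := (hEbox hΔ₁m hb₂m hc).2
    have hG1 : 0 ≤ faceG Δ₁ a c (fermiEnergyOf Δ₁ a b₂ c ν) := hGof hΔ₁m hb₂m hc
    have hGh : 0 ≤ faceG Δ₁ a c Eh := hG1.trans (faceG_mono hΔ₁.le hc0 hε1.le hε1h)
    have hcb₂ : c ≤ b₂ := (hc.2.trans hcb).trans hb₂m.1
    have hmh : c * Eh < a ^ 2 := hmof hc le_rfl hEh0
    have l3 : dWeightFace Δ₁ a b₂ c Eh ≤ dWeightFace Δ₁ a b₂ c (fermiEnergyOf Δ₁ a b₂ c ν) :=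
      dWeightFace_antitone hΔ₁ hc0 hcb₂ ha' hε1 hε1h hmh hG1 (hUof hΔ₁m hb₂m hc hEh0 le_rfl)
    have l4 : dWeightFaceLoDec Δ₁ a b₂ c₁ c₂ Eh ≤ dWeightFace Δ₁ a b₂ c Eh := by
      rw [dWeightFace_eq_CF (by linarith) hc0 hcb₂ hEh0 hmh hGh]
      exact dWeightFaceLoDec_le_CF (by linarith) hEh0 hc₁ hc (hcb.trans hb₂m.1) hm hGh
    exact l4.trans (l3.trans (l2.trans l1))
  · -- UPPER: W(Δ, b, c) ≤ W(Δ₂, b, c) ≤ W(Δ₂, b₁, c) ≤ W(Δ₂, b₁, c₂)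
    have s1 : dWeightFace Δ a b c (fermiEnergyOf Δ a b c ν) ≤ dWeightFace Δ₂ a b c (fermiEnergyOf Δ₂ a b c ν) :=
      hstepΔ hΔ.1 hΔ.2 le_rfl hb hc
    have s2 : dWeightFace Δ₂ a b c (fermiEnergyOf Δ₂ a b c ν) ≤ dWeightFace Δ₂ a b₁ c (fermiEnergyOf Δ₂ a b₁ c ν) :=
      dWeightFace_fermi_anti_tpp hΔ₂ ha hc0 (hc.2.trans hcb) hb.1 hν0 hν1 (hGof hΔ₂m hb₁m hc)
        (hmof hc (hEbox hΔ₂m hb hc).2 (hεpos hΔ₂ hb0 hc0)) (hUof hΔ₂m hb hc (hεpos hΔ₂ hb0 hc0) (hEbox hΔ₂m hb hc).2)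
    have s3 : dWeightFace Δ₂ a b₁ c (fermiEnergyOf Δ₂ a b₁ c ν) ≤ dWeightFace Δ₂ a b₁ c₂ (fermiEnergyOf Δ₂ a b₁ c₂ ν) := by
      refine dWeightFace_fermi_mono_tppP hΔ₂ ha hc0 hc.2 hcb hν0 hν1 (hGof hΔ₂m hb₁m hc) (hGof hΔ₂m hb₁m hc₂m)
        ?_ (hmof hc₂m (hEbox hΔ₂m hb₁m hc).2 (hεpos hΔ₂ hb₁' hc0)) (hUof hΔ₂m hb₁m hc₂m (hεpos hΔ₂ hb₁' hc0) (hEbox hΔ₂m hb₁m hc).2)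
      -- 4(b₁ + c₂) ≤ Δ₂ + Ev ≤ Δ₂ + ε_F(Δ₂, a, b₁, c₂) ≤ Δ₂ + ε_F(Δ₂, a, b₁, c)
      obtain ⟨γ, hCγ⟩ : ∃ γ, c₂ = c + γ := ⟨c₂ - c, by ring⟩
      have hγ : 0 ≤ γ := by linarith [hc.2]
      have h3 : fermiEnergyOf Δ₂ a b₁ c₂ ν ≤ fermiEnergyOf Δ₂ a b₁ c ν := by
        rw [hCγ]; exact fermiEnergyOf_anti_tppP hΔ₂ ha' hc0 hb₁' hγ hν0 hν1 (hex hΔ₂ hb₁' hc0) (hex hΔ₂ hb₁' (by linarith))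
      linarith
    exact s1.trans (s2.trans s3)

/-- **NUMERIC FORM OF THE v2 RULE**: with `faceG(Δ₂, a, c₂; E_v) ≥ 0` and rational bounds `lo ≤ dWeightFaceLoDec(Δ₁, a, b₂, c₁, c₂; E_h)`,
`dWeightFaceCF(Δ₂, a, b₁, c₂; E_v) ≤ hi`: **`W(Δ, a, b, c) ∈ [lo, hi]`** for every member. [folklore] -/
theorem dWeightFace_fermiEnergyOf_mem_Icc_of_mem_box3_dir_num {Δ a b c Δ₁ Δ₂ b₁ b₂ c₁ c₂ ν Eh Ev Elow κ₀ κ lo hi : ℝ} (hΔ₁ : 0 < Δ₁) (ha : 0 < a)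
    (hc₁ : 0 ≤ c₁) (hcb : c₂ ≤ b₁) (hb₁ : 0 < b₁) (hΔ : Δ ∈ Icc Δ₁ Δ₂) (hb : b ∈ Icc b₁ b₂) (hc : c ∈ Icc c₁ c₂) (hν0 : 0 < ν) (hν1 : ν < 1)
    (hVH : ∀ Δ' b' c' : ℝ, Δ' ∈ Icc Δ₁ Δ₂ → b' ∈ Icc b₁ b₂ → c' ∈ Icc c₁ c₂ → 1 - 2 * ν ≤ xVH Δ' a b' c')
    (hEh : fermiEnergyOf Δ₁ a b₂ c₁ ν ≤ Eh) (hm : c₂ * Eh < a ^ 2)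
    (hU11 : 0 ≤ faceU Δ₁ a b₁ c₁ Eh) (hU12 : 0 ≤ faceU Δ₁ a b₁ c₂ Eh) (hU21 : 0 ≤ faceU Δ₂ a b₁ c₁ Eh) (hU22 : 0 ≤ faceU Δ₂ a b₁ c₂ Eh)
    (hEv : Ev ≤ fermiEnergyOf Δ₂ a b₁ c₂ ν) (hEv0 : 0 < Ev) (hR2 : 4 * (b₁ + c₂) ≤ Δ₂ + Ev) (hGv : 0 ≤ faceG Δ₂ a c₂ Ev)
    (hElow : 0 < Elow) (hEl : Elow < Ev) (hκ₀ : 0 ≤ κ₀) (hκ : κ₀ ≤ κ) (hκW : κ + dWeightAxisCF Δ₂ a c₂ Elow < 1)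
    (hlev : c₂ * (Δ₁ * (Elow + Eh) + Elow * Eh) ≤ a ^ 2 * Δ₁) (hsl : c₂ * (Elow + Eh) ≤ a ^ 2)
    (hdir : ∀ D B C e : ℝ, D ∈ Icc Δ₁ Δ₂ → B ∈ Icc b₁ b₂ → C ∈ Icc c₁ c₂ → e ∈ Icc Ev Eh → 0 ≤ faceG D a C e →
      0 ≤ faceSD D a B C e + κ₀ * faceSE D a B C e)
    (hlo : lo ≤ dWeightFaceLoDec Δ₁ a b₂ c₁ c₂ Eh) (hhi : dWeightFaceCF Δ₂ a b₁ c₂ Ev ≤ hi) :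
    dWeightFace Δ a b c (fermiEnergyOf Δ a b c ν) ∈ Icc lo hi := by
  have h := dWeightFace_fermiEnergyOf_mem_Icc_of_mem_box3_dir hΔ₁ ha hc₁ hcb hb₁ hΔ hb hc hν0 hν1 hVH hEh hm hU11 hU12 hU21 hU22 hEv hEv0 hR2
    hElow hEl hκ₀ hκ hκW hlev hsl hdir
  have hΔ₂ : 0 < Δ₂ := lt_of_lt_of_le hΔ₁ (hΔ.1.trans hΔ.2)
  have hc₂ : 0 ≤ c₂ := hc₁.trans (hc.1.trans hc.2)
  have hb₁' : 0 ≤ b₁ := hb₁.le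
  have ha' : a ≠ 0 := ha.ne'
  have hΔ₂m : Δ₂ ∈ Icc Δ₁ Δ₂ := ⟨hΔ.1.trans hΔ.2, le_rfl⟩
  have hb₁m : b₁ ∈ Icc b₁ b₂ := ⟨le_rfl, hb.1.trans hb.2⟩
  have hc₂m : c₂ ∈ Icc c₁ c₂ := ⟨hc.1.trans hc.2, le_rfl⟩
  -- the upper corner: W at ε_F(V_hi) ≤ W at Ev = CF(V_hi; Ev)
  have hεhi : fermiEnergyOf Δ₂ a b₁ c₂ ν ≤ Eh :=
    (fermiEnergyOf_mem_Icc_of_mem_box' hΔ₁ ha hb₁' hc₁ hΔ₂m ⟨le_rfl, le_rfl⟩ hb₁m hc₂m hν0 hν1).2.trans hEh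
  have hmhi : c₂ * fermiEnergyOf Δ₂ a b₁ c₂ ν < a ^ 2 := lt_of_le_of_lt (mul_le_mul_of_nonneg_left hεhi hc₂) hm
  have hmv : c₂ * Ev < a ^ 2 := lt_of_le_of_lt (mul_le_mul_of_nonneg_left (hEv.trans hεhi) hc₂) hm
  have hUhi : cA Δ₂ (fermiEnergyOf Δ₂ a b₁ c₂ ν) ≤ 8 * fsD Δ₂ a c₂ (fermiEnergyOf Δ₂ a b₁ c₂ ν) + 16 * fsN a b₁ c₂ (fermiEnergyOf Δ₂ a b₁ c₂ ν) := by
    have hEh0 : 0 < Eh := hEv0.trans_le (hEv.trans hεhi)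
    have hU := faceU_nonneg_on_box hEh0.le hb₁' hΔ₂m le_rfl hc₂m hU11 hU12 hU21 hU22
    exact faceHi_anti hΔ₂.le hc₂ (by linarith) (hEv0.trans_le hEv) hεhi ((faceU_nonneg_iff _ _ _ _ _).1 hU)
  have hhi' : dWeightFace Δ₂ a b₁ c₂ (fermiEnergyOf Δ₂ a b₁ c₂ ν) ≤ dWeightFaceCF Δ₂ a b₁ c₂ Ev := by
    rw [← dWeightFace_eq_CF (by linarith) hc₂ hcb hEv0 hmv hGv]
    exact dWeightFace_antitone hΔ₂ hc₂ hcb ha' hEv0 hEv hmhi hGv hUhi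
  exact ⟨hlo.trans h.1, (h.2.trans hhi').trans hhi⟩

/-! ## §4 The four-coordinate typed box by normalisation, certificate discharged by the region theorem (`κ₀ = 1/10`) -/

/-- **THE ANTINODAL FERMI-SURFACE Cu-d WEIGHT OVER A TYPED FOUR-COORDINATE BOX, v2 (numeric form, regime only at the upper corner).** For every member
`θ = (Δ, a, b, c)` of `[Δ₁, Δ₂] × [a₁, a₂] × [b₁, b₂] × [c₁, c₂]` (`Δ₁ > 0`, `a₁ > 0`, `c₁ ≥ 0`, `b₁ > 0`) at filling `0 < ν < 1`: with `N` the normalised box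
`[Δ₁/a₂, Δ₂/a₁] × {1} × [b₁/a₂, b₂/a₁] × [c₁/a₂, c₂/a₁]` lying inside the certificate region (`7/10 ≤ Δ₁/a₂`, `Δ₂/a₁ ≤ 16/5`, `3/10 ≤ b₁/a₂`, `b₂/a₁ ≤ 4/5`, `c₂/a₁ ≤ 1/5`,
`7/10 ≤ E_v`, `E_h ≤ 2`) and the hypotheses of `…_box3_dir_num` ON `N` with `κ₀ = 1/10` ⇒ **`W(θ) ∈ [lo, hi]`**. [folklore] -/
theorem dWeightFace_fermiEnergyOf_mem_Icc_of_mem_box4_dir_num {Δ a b c Δ₁ Δ₂ a₁ a₂ b₁ b₂ c₁ c₂ ν Eh Ev Elow κ lo hi : ℝ} (hΔ₁ : 0 < Δ₁) (ha₁ : 0 < a₁)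
    (hc₁ : 0 ≤ c₁) (hb₁ : 0 < b₁) (hcb : c₂ / a₁ ≤ b₁ / a₂) (hΔ : Δ ∈ Icc Δ₁ Δ₂) (ha : a ∈ Icc a₁ a₂) (hb : b ∈ Icc b₁ b₂) (hc : c ∈ Icc c₁ c₂)
    (hν0 : 0 < ν) (hν1 : ν < 1)
    (hVH : ∀ Δ' b' c' : ℝ, Δ' ∈ Icc (Δ₁ / a₂) (Δ₂ / a₁) → b' ∈ Icc (b₁ / a₂) (b₂ / a₁) → c' ∈ Icc (c₁ / a₂) (c₂ / a₁) → 1 - 2 * ν ≤ xVH Δ' 1 b' c')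
    (hEh : fermiEnergyOf (Δ₁ / a₂) 1 (b₂ / a₁) (c₁ / a₂) ν ≤ Eh) (hm : c₂ / a₁ * Eh < 1)
    (hU11 : 0 ≤ faceU (Δ₁ / a₂) 1 (b₁ / a₂) (c₁ / a₂) Eh) (hU12 : 0 ≤ faceU (Δ₁ / a₂) 1 (b₁ / a₂) (c₂ / a₁) Eh)
    (hU21 : 0 ≤ faceU (Δ₂ / a₁) 1 (b₁ / a₂) (c₁ / a₂) Eh) (hU22 : 0 ≤ faceU (Δ₂ / a₁) 1 (b₁ / a₂) (c₂ / a₁) Eh)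
    (hEv : Ev ≤ fermiEnergyOf (Δ₂ / a₁) 1 (b₁ / a₂) (c₂ / a₁) ν) (hEv0 : 0 < Ev) (hR2 : 4 * (b₁ / a₂ + c₂ / a₁) ≤ Δ₂ / a₁ + Ev)
    (hGv : 0 ≤ faceG (Δ₂ / a₁) 1 (c₂ / a₁) Ev)
    (hElow : 0 < Elow) (hEl : Elow < Ev) (hκ : 1 / 10 ≤ κ) (hκW : κ + dWeightAxisCF (Δ₂ / a₁) 1 (c₂ / a₁) Elow < 1)
    (hlev : c₂ / a₁ * (Δ₁ / a₂ * (Elow + Eh) + Elow * Eh) ≤ 1 * (Δ₁ / a₂)) (hsl : c₂ / a₁ * (Elow + Eh) ≤ 1)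
    (hrD1 : 7 / 10 ≤ Δ₁ / a₂) (hrD2 : Δ₂ / a₁ ≤ 16 / 5) (hrb1 : 3 / 10 ≤ b₁ / a₂) (hrb2 : b₂ / a₁ ≤ 4 / 5) (hrc2 : c₂ / a₁ ≤ 1 / 5)
    (hrEv : 7 / 10 ≤ Ev) (hrEh : Eh ≤ 2)
    (hlo : lo ≤ dWeightFaceLoDec (Δ₁ / a₂) 1 (b₂ / a₁) (c₁ / a₂) (c₂ / a₁) Eh) (hhi : dWeightFaceCF (Δ₂ / a₁) 1 (b₁ / a₂) (c₂ / a₁) Ev ≤ hi) :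
    dWeightFace Δ a b c (fermiEnergyOf Δ a b c ν) ∈ Icc lo hi := by
  have ha0 : 0 < a := lt_of_lt_of_le ha₁ ha.1
  have ha₂ : 0 < a₂ := lt_of_lt_of_le ha0 ha.2
  have hc₁n : 0 ≤ c₁ / a₂ := div_nonneg hc₁ ha₂.le
  have hb₁n : 0 < b₁ / a₂ := div_pos hb₁ ha₂
  rw [dWeightFace_fermiEnergyOf_eq_ratios ha0]
  have hΔn := div_mem_Icc_of_mem ha₁ hΔ₁.le hΔ ha
  have hbn := div_mem_Icc_of_mem ha₁ hb₁.le hb ha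
  have hcn := div_mem_Icc_of_mem ha₁ hc₁ hc ha
  refine dWeightFace_fermiEnergyOf_mem_Icc_of_mem_box3_dir_num (κ₀ := 1 / 10) (div_pos hΔ₁ ha₂) one_pos hc₁n hcb hb₁n hΔn hbn hcn hν0 hν1
    hVH hEh (by simpa using hm) hU11 hU12 hU21 hU22 hEv hEv0 hR2 hGv hElow hEl (by norm_num) hκ hκW (by simpa using hlev) (by simpa using hsl) ?_ hlo hhi
  intro D B C e hD hB hC he hG
  exact faceDir_nonneg_of_mem_region ⟨hrD1.trans hD.1, hD.2.trans hrD2⟩ ⟨hrEv.trans he.1, he.2.trans hrEh⟩ ⟨hrb1.trans hB.1, hB.2.trans hrb2⟩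
    ⟨hc₁n.trans hC.1, hC.2.trans hrc2⟩ hG

end Summit.Ventures.CertifiedManyBodySolver.Downfold.Emery
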